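import Literature.NumberTheory.Rogawski1990.TamagawaSingularMembersFinTFCovolOrgans   -- ★ p848038 (LH5-p02): the letter's conjuncts NAMED — `FinTFCovolQfinAt` (Q-fin), `FinTFCovolTprimeAt` (T′)
import Literature.NumberTheory.Rogawski1990.TamagawaSingularFinPartners               -- ★ p847832∕p847860 (LH5-p01): `singularGuard_conj`, `not_isRegularElt_and_corresponds_self`
import Literature.NumberTheory.Automorphic.OrbitalMeasureQuotientOfAgree              -- ★ p848196 (LH5-p04): `IsQuotientOf.atPoint_eq_atPoint_of_isQuotientOf_of_forall_conj`
import HarnessLib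

/-!
# [Rogawski1990 §14.5 L. 14.5.2 (b) pp. 238–239; §4.3 pp. 43–44; §5.4 p. 72] S1′-fin-TF-COVOL — ORGAN O6′ «T′-TRANSPORT»: the covolume conjunct (T′) of the
# letter passes between two finite member families of the SAME local Weil partners

Topic `NumberTheory/Rogawski1990`; namespace `Literature.NumberTheory.Rogawski1990`.  THEOREMS ONLY over accepted tree modules (no definition, no named fact,
no instance, no notation, no `sorry`).  Cell `pub/hodgecm-mathlib`, crux H413 = stmt-HodgeConjecture-24833, GO-500 half A line **LH5** — pay-down of the closer
stub `stub_S1finTFCovol : TamagawaSingularMembersFinTFCovolClosed` (`Cruxes/H413/Lines/F0_U3LettersRung1.lean` ED. 38; books row III-121 (#175)); skeleton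
`F0_P3c_S1finTFCovolPaydown` v1 9456d302f4282333 (LH5-plan (g0)), organ O6′ dealt to LH5-p04 (g0) 2026-09-02 (deal (4′)).

THE POINT.  The letter ★ `TamagawaSingularMembersFinTFCovol` (p844690) is `∃ mGs tGs, (Q-fin) ∧ (COH-fin) ∧ (C1)-fin ∧ (NORM) ∧ (T′) ∧ κ-block-TF`; its conjuncts
are NAMED by ★ `TamagawaSingularMembersFinTFCovolOrgans` (p848038: `FinTFCovolQfinAt`, …, `FinTFCovolTprimeAt`, token-equal to the letter by
★ `tamagawaSingularMembersFinTFCovol_iff_organs := Iff.rfl`).  The covolume conjunct (T′)[mGs, tGs] reads the MEMBERS `mGs` at exactly one place: the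
antecedent clause `UnitaryGroup.IsNormalisedOff L 3 H′ mGs (γ_c) S₀` («`mGs` is normalised at the singular class `c` off `S₀`», [§4.3 p. 44; §5.4 p. 72]) —
everything else in (T′) (the restricted-product tower `ρ, ρM, tf, tP, tA` and the level clause) is spelled on the PARTNERS `tGs v (γ_c)_v`.  By (Q-fin) the member
`mGs v` IS the Weil quotient `dνG_v ∕ d(tGs v ·)` on the guarded classes (★ `OrbitalMeasureFamily.IsQuotientOf`), and the rational point `(γ_c)_v` is guarded
(witness `γ₀ := out c`, ★ `not_isRegularElt_and_corresponds_self`; the guard is conjugation-stable, ★ `singularGuard_conj`), so two member families `mGs₀`,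
`mGs` of the SAME partners agree read at `(γ_c)_v` (★ `IsQuotientOf.atPoint_eq_atPoint_of_isQuotientOf_of_forall_conj`, p848196) and `IsNormalisedOff` is the
same clause for both.  Hence **(T′)[mGs₀, tGs] → (T′)[mGs, tGs]** whenever both are (Q-fin) families of `tGs` — NO conjugation-coherence (COH-fin) is needed.
In the LH5 skeleton this carries (T′) from the members `mGs₀` a print organ brings (O1 «κ-SYSTEM» ∕ O1⁺) to the members `mGs` of ★
`exists_singularFinMembers_of_partners` (p847860) that the composition uses; its κ-twin is O6 «κ-TRANSPORT» (LH5-p01).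

* `atPoint_toLocal_eq_of_finTFCovolQfinAt` — two (Q-fin) member families of the same partners agree READ AT every non-regular rational point `(γ₀)_v`;
* `isNormalisedOff_iff_of_finTFCovolQfinAt` — hence `IsNormalisedOff L 3 H′ mGs (γ₀ ⊗ 1) S₀ ↔ IsNormalisedOff L 3 H′ mGs₀ (γ₀ ⊗ 1) S₀` (same `S₀`);
* **`finTFCovolTprimeAt_of_finTFCovolQfinAt`** — ORGAN O6′: `(Q-fin)[mGs₀, tGs] → (Q-fin)[mGs, tGs] → (T′)[mGs₀, tGs] → (T′)[mGs, tGs]`.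

HONEST LABEL.  Measure-theoretic bookkeeping inside the letter; proves no printed statement.  HC_CM is proved only modulo the 7 printed citations (2 remaining:
hLiu418 = stmt-HodgeConjecture-24832, h413 = stmt-HodgeConjecture-24833) until rung 0 closes.

## References
* [Rogawski1990] J. D. Rogawski, *Automorphic Representations of Unitary Groups in Three Variables*, Ann. of Math. Stud. 123 (1990): §14.5 Lemma 14.5.2 (b)
  pp. 238–239; §4.3 (4.3.1) pp. 43–44; §5.4 p. 72; §1.7 p. 6.
* [DeitmarEchterhoff2014] A. Deitmar, S. Echterhoff, *Principles of Harmonic Analysis*, 2nd ed. (2014), Thm. 1.5.3.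
-/

set_option autoImplicit false

noncomputable section

open MeasureTheory Measure NumberField IsDedekindDomain
open Literature.MeasureTheory.Group Literature.MeasureTheory.RestrictedProduct
open Literature.Topology.RestrictedProduct Literature.Topology.Algebra.RestrictedProduct
open scoped Matrix MatrixGroups RestrictedProduct

namespace Literature.NumberTheory.Rogawski1990

open Literature.NumberTheory.Automorphic
open Literature.AlgebraicGeometry.ShimuraVarieties (unitaryGroup hermForm)

section Frame

variable (L : Type) [Field L] [NumberField L] [IsCMField L] (H' : Matrix (Fin 3) (Fin 3) L)
    [∀ (v : HeightOneSpectrum (𝓞 ↥(maximalRealSubfield L))) (γ : (UnitaryGroup.cmDatum L 3 H').Local v),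
      MeasurableSpace ((UnitaryGroup.cmDatum L 3 H').Local v ⧸ Subgroup.centralizer ({γ} : Set ((UnitaryGroup.cmDatum L 3 H').Local v)))]
    [∀ (v : HeightOneSpectrum (𝓞 ↥(maximalRealSubfield L))) (γ : (UnitaryGroup.cmDatum L 3 H').Local v),
      BorelSpace ((UnitaryGroup.cmDatum L 3 H').Local v ⧸ Subgroup.centralizer ({γ} : Set ((UnitaryGroup.cmDatum L 3 H').Local v)))]
    [∀ v : HeightOneSpectrum (𝓞 ↥(maximalRealSubfield L)), MeasurableSpace ((UnitaryGroup.cmDatum L 3 H').Local v)]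
    [∀ v : HeightOneSpectrum (𝓞 ↥(maximalRealSubfield L)), BorelSpace ((UnitaryGroup.cmDatum L 3 H').Local v)]
    {νG : ∀ v : HeightOneSpectrum (𝓞 ↥(maximalRealSubfield L)), Measure ((UnitaryGroup.cmDatum L 3 H').Local v)}
    [∀ v, (νG v).IsHaarMeasure] [∀ v, (νG v).IsMulRightInvariant]
    {mGs mGs₀ : ∀ v : HeightOneSpectrum (𝓞 ↥(maximalRealSubfield L)), OrbitalMeasureFamily ((UnitaryGroup.cmDatum L 3 H').Local v)}
    {tGs : ∀ (v : HeightOneSpectrum (𝓞 ↥(maximalRealSubfield L))) (γ : (UnitaryGroup.cmDatum L 3 H').Local v),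
      Measure ↥(Subgroup.centralizer ({γ} : Set ((UnitaryGroup.cmDatum L 3 H').Local v)))}

/-! ## §1 Two (Q-fin) member families of the same partners agree at the non-regular rational points -/

/-- **Two (Q-fin) member families of the SAME partners `tGs` agree READ AT every non-regular rational point**: for `γ₀ ∈ U(H′)(L⁺)` non-regular and every
finite `v`, `(mGs v).atPoint (γ₀)_v = (mGs₀ v).atPoint (γ₀)_v` — `(γ₀)_v` is a guard point of (Q-fin) (★ `not_isRegularElt_and_corresponds_self`), the guard is
conjugation-stable (★ `singularGuard_conj`), and on the guard both members are the Weil quotient `dνG_v ∕ d(tGs v ·)` (★ p848196). «we may therefore set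
`Φ(γ, f) = Π_v Φ(γ, f_v)`» — the local factor at `γ₀` is determined by `(νG_v, tGs v)`. [cite: Rogawski1990, §4.3 (4.3.1) pp. 43–44; §1.7 p. 6]
[cite: DeitmarEchterhoff2014, Thm. 1.5.3] -/
theorem atPoint_toLocal_eq_of_finTFCovolQfinAt (hQ : FinTFCovolQfinAt L H' νG mGs tGs) (hQ₀ : FinTFCovolQfinAt L H' νG mGs₀ tGs)
    (γ₀ : (UnitaryGroup.cmDatum L 3 H').Rational) (hγ₀ : ¬ IsRegularElt (γ₀.val : GL (Fin 3) L)) (v : HeightOneSpectrum (𝓞 ↥(maximalRealSubfield L))) :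
    (mGs v).atPoint ((UnitaryGroup.cmDatum L 3 H').toLocal v ((UnitaryGroup.cmDatum L 3 H').toAdelic γ₀)) =
      (mGs₀ v).atPoint ((UnitaryGroup.cmDatum L 3 H').toLocal v ((UnitaryGroup.cmDatum L 3 H').toAdelic γ₀)) :=
  (hQ v).atPoint_eq_atPoint_of_isQuotientOf_of_forall_conj (hQ₀ v) (fun x q hx => singularGuard_conj L H' v x q hx) _
    (not_isRegularElt_and_corresponds_self L H' v γ₀ hγ₀)

/-- **Hence «normalised at `γ₀` off `S₀`» (★ `UnitaryGroup.IsNormalisedOff`: the member at `(γ₀)_v` gives the `K_v`-orbit piece mass one for `v ∉ S₀`) is the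
SAME clause for two (Q-fin) member families of the same partners.** [cite: Rogawski1990, §4.3 p. 44; §5.4 p. 72] -/
theorem isNormalisedOff_iff_of_finTFCovolQfinAt (hQ : FinTFCovolQfinAt L H' νG mGs tGs) (hQ₀ : FinTFCovolQfinAt L H' νG mGs₀ tGs)
    (γ₀ : (UnitaryGroup.cmDatum L 3 H').Rational) (hγ₀ : ¬ IsRegularElt (γ₀.val : GL (Fin 3) L)) (S₀ : Finset (HeightOneSpectrum (𝓞 ↥(maximalRealSubfield L)))) :
    UnitaryGroup.IsNormalisedOff L 3 H' mGs ((UnitaryGroup.cmDatum L 3 H').toAdelic γ₀) S₀ ↔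
      UnitaryGroup.IsNormalisedOff L 3 H' mGs₀ ((UnitaryGroup.cmDatum L 3 H').toAdelic γ₀) S₀ := by
  unfold UnitaryGroup.IsNormalisedOff
  simp only [atPoint_toLocal_eq_of_finTFCovolQfinAt L H' hQ hQ₀ γ₀ hγ₀]

/-! ## §2 ORGAN O6′ «T′-TRANSPORT» -/

variable [MeasurableSpace (UnitaryGroup.cmDatum L 3 H').Adelic] [BorelSpace (UnitaryGroup.cmDatum L 3 H').Adelic]
    [MeasurableSpace (UnitaryGroup.arch (↥(maximalRealSubfield L)) L (IsCMField.complexConj L) 3 H')]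
    [∀ γ : (UnitaryGroup.cmDatum L 3 H').Adelic, MeasurableSpace (↥(Subgroup.centralizer ({γ} : Set (UnitaryGroup.cmDatum L 3 H').Adelic)) ⧸
      ((UnitaryGroup.cmDatum L 3 H').quotientSubgroup ⊓ Subgroup.centralizer ({γ} : Set (UnitaryGroup.cmDatum L 3 H').Adelic)).subgroupOf (Subgroup.centralizer ({γ} : Set (UnitaryGroup.cmDatum L 3 H').Adelic)))]
    [∀ γ : (UnitaryGroup.cmDatum L 3 H').Adelic, BorelSpace (↥(Subgroup.centralizer ({γ} : Set (UnitaryGroup.cmDatum L 3 H').Adelic)) ⧸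
      ((UnitaryGroup.cmDatum L 3 H').quotientSubgroup ⊓ Subgroup.centralizer ({γ} : Set (UnitaryGroup.cmDatum L 3 H').Adelic)).subgroupOf (Subgroup.centralizer ({γ} : Set (UnitaryGroup.cmDatum L 3 H').Adelic)))]
    [hCcl : ∀ γ : (UnitaryGroup.cmDatum L 3 H').Adelic, IsClosed ((Subgroup.centralizer ({γ} : Set (UnitaryGroup.cmDatum L 3 H').Adelic) : Subgroup (UnitaryGroup.cmDatum L 3 H').Adelic) : Set (UnitaryGroup.cmDatum L 3 H').Adelic)]
    [∀ γ : (UnitaryGroup.cmDatum L 3 H').Adelic, (count : Measure ↥(((UnitaryGroup.cmDatum L 3 H').quotientSubgroup ⊓ Subgroup.centralizer ({γ} : Set (UnitaryGroup.cmDatum L 3 H').Adelic)).subgroupOf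
      (Subgroup.centralizer ({γ} : Set (UnitaryGroup.cmDatum L 3 H').Adelic)))).IsHaarMeasure]

set_option maxHeartbeats 16000000 in
set_option synthInstance.maxHeartbeats 800000 in
-- HB: the proof unfolds the (T′) tower statement twice (goal and `hT₀`) on the concrete `cmDatum` ∕ restricted-product carriers and matches them — the budget of the
-- letter ★ p844690 and of ★ `tamagawaSingularMembersFinTFCovol_iff_organs` (p848038), whose statements are this same term
/-- **ORGAN O6′ «T′-TRANSPORT» [Rogawski1990 §14.5 L. 14.5.2 (b) pp. 238–239 «`m(Z G′_{γ^δ}∖G′_{γ^δ}) = m(Z_H∖H)`»; §4.3 p. 44; §5.4 p. 72].**  For two member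
families `mGs₀`, `mGs` that are BOTH (Q-fin) families of the same partners `tGs` (Weil quotients `dνG_v ∕ d(tGs v ·)` on the guarded classes), the covolume
conjunct (T′) of ★ `TamagawaSingularMembersFinTFCovol` passes from `mGs₀` to `mGs` VERBATIM: (T′) reads the members only through the antecedent clause
`IsNormalisedOff L 3 H′ mGs (γ_c) S₀` at the singular non-central classes `c` (`γ_c = out c ⊗ 1` non-regular rational), where the two families agree
(`isNormalisedOff_iff_of_finTFCovolQfinAt`, same `S₀`); the tower data `ρ, ρM, tf, tP, tA` and the level clause are spelled on `tGs` and pass untouched.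
No (COH-fin) hypothesis.  In the LH5 skeleton: `(T′)[members of O1 ∕ O1⁺] ⟹ (T′)[members of ★ exists_singularFinMembers_of_partners]`.
[cite: Rogawski1990, §14.5 Lemma 14.5.2 (b) pp. 238–239; §4.3 pp. 43–44; §5.4 p. 72] -/
theorem finTFCovolTprimeAt_of_finTFCovolQfinAt (hQ₀ : FinTFCovolQfinAt L H' νG mGs₀ tGs) (hQ : FinTFCovolQfinAt L H' νG mGs tGs)
    (hT₀ : FinTFCovolTprimeAt L H' mGs₀ tGs) : FinTFCovolTprimeAt L H' mGs tGs := by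
  intro i₁ i₂ i₃ i₄ ψ hψ e he hec hes hg tA hA₁ hA₂ hA₃ hant
  exact hT₀ ψ hψ e he hec hes hg tA hA₁ hA₂ hA₃ fun c hreg hcen => by
    obtain ⟨S₀, hN, hrest⟩ := hant c hreg hcen
    exact ⟨S₀, (isNormalisedOff_iff_of_finTFCovolQfinAt L H' hQ hQ₀ (Quotient.out c) hreg S₀).1 hN, hrest⟩

end Frame

end Literature.NumberTheory.Rogawski1990

end
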